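import Summits.NavierStokesRegularity.NavierStokesRegularity.Theorems.ExtremiserTransienceNearExtremalTransienceExtremiserLiouvilleConstantSpeedTools
import HarnessLib

/-!
# Crux `ExtremiserTransience.NearExtremalTransience` (stmt-NavierStokesRegularity-21883), line `extremiser_liouville`,
# stub K1b — LIOUVILLE FOR CONSTANT-SPEED DIVERGENCE-FREE FIELDS WITH VANISHING LATERAL FLUX

`--supports stmt-NavierStokesRegularity-21883` (helper).  Author: prover seat `ns-el-k1b` (g2).

`eq_farField_of_constSpeed_of_lateralFlux`: a `C¹` divergence-free field `w` with CONSTANT speed `‖w‖ ≡ M = ‖c‖` whose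
deviation `V := w − c` has vanishing dyadic lateral flux, `R⁻¹ ∫_{R ≤ ‖x‖ ≤ 2R} ‖V‖ → 0`, is the constant `c`.

Mechanism (the «flux Liouville» of the crux record): `⟪V, c⟫ = −‖V‖²/2 ≤ 0` pointwise, and testing `div V = 0` against
`θ_R := arctan⟪c, ·⟫ · χ_R` gives `½ ∫ χ_R ‖V‖²/(1 + ⟪c,x⟫²) = ∫ arctan⟪c,x⟫ · Dχ_R(V) = O(R⁻¹ ∫_{A_R} ‖V‖) → 0`.
This kills every constant-speed extended extremiser whose deviation from its far field decays faster than `|x|⁻²` in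
the dyadic-`L¹` sense (e.g. `V ∈ L^{3/2}`); the rate `|x|⁻¹` permitted by `DV ∈ L², V ∈ L⁶` is NOT covered — that slowly
decaying regime is what remains of K1b.

WHAT THIS IS NOT: nothing here proves NS regularity. [folklore]
-/

noncomputable section

open Set Filter Topology MeasureTheory Metric Function
open scoped ENNReal NNReal Topology InnerProductSpace RealInnerProductSpace ContDiff
open Literature.Analysis.FluidPDE Literature.Analysis

namespace Summit.NavierStokesRegularity.NavierStokesRegularity.Theorems

-- the problem directory repeats the summit name (`NavierStokesRegularity/NavierStokesRegularity`)
set_option linter.dupNamespace false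

namespace ExtremiserLiouville

/-- The derivative of the cut-off `χ_R` vanishes off the annulus `R ≤ ‖x‖ ≤ 2R`. [folklore] -/
theorem fderiv_cutoff_eq_zero_of_notMem {R : ℝ} (hR : 0 < R) {x : EuclideanSpace ℝ (Fin 3)}
    (hx : x ∉ {x : EuclideanSpace ℝ (Fin 3) | R ≤ ‖x‖ ∧ ‖x‖ ≤ 2 * R}) :
    fderiv ℝ (cutoff R) x = 0 := by
  simp only [mem_setOf_eq, not_and_or, not_le] at hx
  rcases hx with h | h
  · have hev : cutoff (E := EuclideanSpace ℝ (Fin 3)) R =ᶠ[𝓝 x] fun _ => (1 : ℝ) := by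
      filter_upwards [(isOpen_lt continuous_norm continuous_const).mem_nhds h] with y hy
      exact cutoff_eq_one hR (le_of_lt hy)
    rw [hev.fderiv_eq, fderiv_const_apply]
  · have hev : cutoff (E := EuclideanSpace ℝ (Fin 3)) R =ᶠ[𝓝 x] fun _ => (0 : ℝ) := by
      filter_upwards [(isOpen_lt continuous_const continuous_norm).mem_nhds h] with y hy
      exact cutoff_eq_zero hR (le_of_lt hy)
    rw [hev.fderiv_eq, fderiv_const_apply]

/-- `‖Dχ_R(x) u‖ ≤ (C/R) · 𝟙_{R ≤ ‖x‖ ≤ 2R}(x) · ‖u‖`. [folklore] -/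
theorem exists_norm_fderiv_cutoff_apply_le :
    ∃ C : ℝ, 0 ≤ C ∧ ∀ R : ℝ, 0 < R → ∀ x u : EuclideanSpace ℝ (Fin 3),
      ‖fderiv ℝ (cutoff R) x u‖ ≤ C / R * {x : EuclideanSpace ℝ (Fin 3) | R ≤ ‖x‖ ∧ ‖x‖ ≤ 2 * R}.indicator (fun _ => ‖u‖) x := by
  obtain ⟨C, hC0, hC⟩ := exists_norm_fderiv_cutoff_le (E := EuclideanSpace ℝ (Fin 3))
  refine ⟨C, hC0, fun R hR x u => ?_⟩
  by_cases hx : x ∈ {x : EuclideanSpace ℝ (Fin 3) | R ≤ ‖x‖ ∧ ‖x‖ ≤ 2 * R}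
  · rw [indicator_of_mem hx]
    exact ((fderiv ℝ (cutoff R) x).le_opNorm u).trans (mul_le_mul_of_nonneg_right (hC R hR x) (norm_nonneg _))
  · rw [fderiv_cutoff_eq_zero_of_notMem hR hx, indicator_of_notMem hx, mul_zero]
    simp

variable {V : EuclideanSpace ℝ (Fin 3) → EuclideanSpace ℝ (Fin 3)} {c : EuclideanSpace ℝ (Fin 3)}

/-- **The tested identity.**  For `V ∈ C¹` divergence free with `⟪V x, c⟫ = −‖V x‖²/2`:
`½ ∫ χ_R ‖V‖²/(1+⟪c,x⟫²) = ∫ arctan⟪c,x⟫ · Dχ_R(x)(V x)`. [folklore] -/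
theorem integral_cutoff_weight_eq (hV : ContDiff ℝ 1 V) (hdiv : VectorCalculus.IsDivFree V)
    (hVc : ∀ x, ⟪V x, c⟫ = -(‖V x‖ ^ 2 / 2)) {R : ℝ} (hR : 0 < R) :
    (∫ x, cutoff R x * (‖V x‖ ^ 2 / (1 + ⟪c, x⟫ ^ 2))) =
      2 * ∫ x, Real.arctan ⟪c, x⟫ * fderiv ℝ (cutoff R) x (V x) := by
  -- the test function `θ_R = arctan⟪c,·⟫ · χ_R`
  have harc : ContDiff ℝ 1 fun x : EuclideanSpace ℝ (Fin 3) => Real.arctan ⟪c, x⟫ :=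
    Real.contDiff_arctan.comp (contDiff_const.inner ℝ contDiff_id)
  have hθ : ContDiff ℝ 1 fun x => Real.arctan ⟪c, x⟫ * cutoff R x := harc.mul (contDiff_cutoff R)
  have hθc : HasCompactSupport fun x => Real.arctan ⟪c, x⟫ * cutoff R x := (hasCompactSupport_cutoff hR).mul_left
  have hibp := integral_mul_divergence_add_eq_zero_left hθ hV hθc
  have hzero : (∫ x, Real.arctan ⟪c, x⟫ * cutoff R x * VectorCalculus.divergence V x) = 0 := by
    simp [hdiv _]
  rw [hzero, zero_add] at hibp
  -- the derivative of `θ_R` along `V`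
  have hD : ∀ x, ⟪V x, gradient (fun x => Real.arctan ⟪c, x⟫ * cutoff R x) x⟫ =
      Real.arctan ⟪c, x⟫ * fderiv ℝ (cutoff R) x (V x) - cutoff R x * (‖V x‖ ^ 2 / (1 + ⟪c, x⟫ ^ 2)) / 2 := by
    intro x
    rw [real_inner_comm, gradient, InnerProductSpace.toDual_symm_apply]
    have h1 : HasFDerivAt (fun x : EuclideanSpace ℝ (Fin 3) => Real.arctan ⟪c, x⟫)
        ((1 / (1 + ⟪c, x⟫ ^ 2)) • innerSL ℝ c) x := by
      have h := (Real.hasDerivAt_arctan ⟪c, x⟫).comp_hasFDerivAt x (innerSL ℝ c).hasFDerivAt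
      exact h
    have h2 : HasFDerivAt (cutoff (E := EuclideanSpace ℝ (Fin 3)) R) (fderiv ℝ (cutoff R) x) x :=
      (((contDiff_cutoff (n := 1) R).differentiable one_ne_zero) x).hasFDerivAt
    have h12 : HasFDerivAt (fun x : EuclideanSpace ℝ (Fin 3) => Real.arctan ⟪c, x⟫ * cutoff R x)
        (Real.arctan ⟪c, x⟫ • fderiv ℝ (cutoff R) x + cutoff R x • ((1 / (1 + ⟪c, x⟫ ^ 2)) • innerSL ℝ c)) x :=
      h1.mul h2
    rw [h12.fderiv]
    have happ : (Real.arctan ⟪c, x⟫ • fderiv ℝ (cutoff R) x + cutoff R x • ((1 / (1 + ⟪c, x⟫ ^ 2)) • innerSL ℝ c)) (V x) =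
        Real.arctan ⟪c, x⟫ * fderiv ℝ (cutoff R) x (V x) + cutoff R x * ((1 / (1 + ⟪c, x⟫ ^ 2)) * ⟪c, V x⟫) := by
      rfl
    rw [happ, real_inner_comm (V x) c, hVc x]
    field_simp
    ring
  simp_rw [hD] at hibp
  -- split the integral
  have hint1 : Integrable (fun x => Real.arctan ⟪c, x⟫ * fderiv ℝ (cutoff R) x (V x)) volume := by
    refine Continuous.integrable_of_hasCompactSupport ?_ ?_
    · exact (Real.continuous_arctan.comp (continuous_const.inner continuous_id)).mul
        (((contDiff_cutoff (n := 1) R).continuous_fderiv one_ne_zero).clm_apply hV.continuous)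
    · refine HasCompactSupport.intro (isCompact_closedBall (0 : EuclideanSpace ℝ (Fin 3)) (2 * R)) fun x hx => ?_
      rw [mem_closedBall_zero_iff, not_le] at hx
      have : x ∉ {x : EuclideanSpace ℝ (Fin 3) | R ≤ ‖x‖ ∧ ‖x‖ ≤ 2 * R} := fun h => (not_le.2 hx) h.2
      rw [fderiv_cutoff_eq_zero_of_notMem hR this]
      simp
  have hint2 : Integrable (fun x => cutoff R x * (‖V x‖ ^ 2 / (1 + ⟪c, x⟫ ^ 2)) / 2) volume := by
    refine Continuous.integrable_of_hasCompactSupport ?_ ?_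
    · refine ((contDiff_cutoff (n := 1) R).continuous.mul ((hV.continuous.norm.pow 2).div
        (continuous_const.add ((continuous_const.inner continuous_id).pow 2)) fun x => ?_)).div_const _
      have : (0 : ℝ) < 1 + ⟪c, x⟫ ^ 2 := by positivity
      exact this.ne'
    · exact ((hasCompactSupport_cutoff hR).mul_right).mul_right
  rw [integral_sub hint1 hint2, sub_eq_zero] at hibp
  have h2 : (∫ x, cutoff R x * (‖V x‖ ^ 2 / (1 + ⟪c, x⟫ ^ 2)) / 2) = (∫ x, cutoff R x * (‖V x‖ ^ 2 / (1 + ⟪c, x⟫ ^ 2))) / 2 :=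
    integral_div _ _
  rw [h2] at hibp
  linarith

/-- **The flux bound**: `∫ χ_R ‖V‖²/(1+⟪c,x⟫²) ≤ π (C/R) ∫_{R ≤ ‖x‖ ≤ 2R} ‖V‖`. [folklore] -/
theorem integral_cutoff_weight_le (hV : ContDiff ℝ 1 V) (hdiv : VectorCalculus.IsDivFree V)
    (hVc : ∀ x, ⟪V x, c⟫ = -(‖V x‖ ^ 2 / 2)) :
    ∃ C : ℝ, 0 ≤ C ∧ ∀ R : ℝ, 0 < R →
      (∫ x, cutoff R x * (‖V x‖ ^ 2 / (1 + ⟪c, x⟫ ^ 2))) ≤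
        Real.pi * (C / R) * ∫ x in {x : EuclideanSpace ℝ (Fin 3) | R ≤ ‖x‖ ∧ ‖x‖ ≤ 2 * R}, ‖V x‖ := by
  obtain ⟨C, hC0, hC⟩ := exists_norm_fderiv_cutoff_apply_le
  refine ⟨C, hC0, fun R hR => ?_⟩
  rw [integral_cutoff_weight_eq hV hdiv hVc hR, ← integral_indicator (measurableSet_annulus R)]
  have hbound : ∀ x, ‖Real.arctan ⟪c, x⟫ * fderiv ℝ (cutoff R) x (V x)‖ ≤
      Real.pi / 2 * (C / R) * {x : EuclideanSpace ℝ (Fin 3) | R ≤ ‖x‖ ∧ ‖x‖ ≤ 2 * R}.indicator (fun x => ‖V x‖) x := by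
    intro x
    rw [norm_mul, Real.norm_eq_abs]
    have ha : |Real.arctan ⟪c, x⟫| ≤ Real.pi / 2 :=
      abs_le.2 ⟨(Real.neg_pi_div_two_lt_arctan _).le, (Real.arctan_lt_pi_div_two _).le⟩
    have hb := hC R hR x (V x)
    have hind : {x : EuclideanSpace ℝ (Fin 3) | R ≤ ‖x‖ ∧ ‖x‖ ≤ 2 * R}.indicator (fun _ => ‖V x‖) x =
        {x : EuclideanSpace ℝ (Fin 3) | R ≤ ‖x‖ ∧ ‖x‖ ≤ 2 * R}.indicator (fun x => ‖V x‖) x := by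
      by_cases hx : x ∈ {x : EuclideanSpace ℝ (Fin 3) | R ≤ ‖x‖ ∧ ‖x‖ ≤ 2 * R}
      · rw [indicator_of_mem hx, indicator_of_mem hx]
      · rw [indicator_of_notMem hx, indicator_of_notMem hx]
    rw [hind] at hb
    have hnn : 0 ≤ C / R * {x : EuclideanSpace ℝ (Fin 3) | R ≤ ‖x‖ ∧ ‖x‖ ≤ 2 * R}.indicator (fun x => ‖V x‖) x :=
      mul_nonneg (div_nonneg hC0 hR.le) (indicator_nonneg (fun _ _ => norm_nonneg _) _)
    calc |Real.arctan ⟪c, x⟫| * ‖fderiv ℝ (cutoff R) x (V x)‖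
        ≤ Real.pi / 2 * (C / R * {x : EuclideanSpace ℝ (Fin 3) | R ≤ ‖x‖ ∧ ‖x‖ ≤ 2 * R}.indicator (fun x => ‖V x‖) x) :=
          mul_le_mul ha hb (norm_nonneg _) (by positivity)
      _ = _ := by ring
  have hint : Integrable (fun x => Real.pi / 2 * (C / R) *
      {x : EuclideanSpace ℝ (Fin 3) | R ≤ ‖x‖ ∧ ‖x‖ ≤ 2 * R}.indicator (fun x => ‖V x‖) x) volume := by
    refine Integrable.const_mul ?_ _
    rw [integrable_indicator_iff (measurableSet_annulus R)]
    refine hV.continuous.norm.continuousOn.integrableOn_compact ?_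
    exact (isCompact_closedBall (0 : EuclideanSpace ℝ (Fin 3)) (2 * R)).of_isClosed_subset
      ((isClosed_le continuous_const continuous_norm).inter (isClosed_le continuous_norm continuous_const))
      fun x hx => mem_closedBall_zero_iff.2 hx.2
  have h := norm_integral_le_of_norm_le hint (Eventually.of_forall hbound)
  rw [integral_const_mul, Real.norm_eq_abs] at h
  have h' := (le_abs_self _).trans h
  linarith

/-- **Liouville for constant-speed divergence-free fields with vanishing lateral flux.**  If `‖w‖ ≡ M = ‖c‖`, `w ∈ C¹`,
`div w = 0`, and `R⁻¹ ∫_{R ≤ ‖x‖ ≤ 2R} ‖w − c‖ → 0`, then `w ≡ c`. [folklore] -/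
theorem eq_farField_of_constSpeed_of_lateralFlux {w : EuclideanSpace ℝ (Fin 3) → EuclideanSpace ℝ (Fin 3)}
    (hw : ContDiff ℝ 1 w) (hdiv : VectorCalculus.IsDivFree w) {M : ℝ} {c : EuclideanSpace ℝ (Fin 3)}
    (hM : ∀ x, ‖w x‖ = M) (hcM : ‖c‖ = M)
    (hflux : Tendsto (fun R : ℝ => R⁻¹ * ∫ x in {x : EuclideanSpace ℝ (Fin 3) | R ≤ ‖x‖ ∧ ‖x‖ ≤ 2 * R}, ‖w x - c‖)
      atTop (𝓝 0)) :
    ∀ x, w x = c := by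
  set V : EuclideanSpace ℝ (Fin 3) → EuclideanSpace ℝ (Fin 3) := fun x => w x - c with hVdef
  have hV : ContDiff ℝ 1 V := hw.sub contDiff_const
  have hVdiv : VectorCalculus.IsDivFree V := isDivFree_sub_const hdiv c
  have hVc : ∀ x, ⟪V x, c⟫ = -(‖V x‖ ^ 2 / 2) := fun x => by
    have h : ‖c + V x‖ = ‖c‖ := by simp only [hVdef, add_sub_cancel]; rw [hM x, hcM]
    exact (inner_eq_of_norm_add_eq h).1
  obtain ⟨C, hC0, hC⟩ := integral_cutoff_weight_le hV hVdiv hVc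
  -- the weight `g = ‖V‖²/(1+⟪c,x⟫²)` and the tested integrals
  set g : EuclideanSpace ℝ (Fin 3) → ℝ := fun x => ‖V x‖ ^ 2 / (1 + ⟪c, x⟫ ^ 2) with hg
  have hgc : Continuous g := by
    refine (hV.continuous.norm.pow 2).div (continuous_const.add ((continuous_const.inner continuous_id).pow 2))
      fun x => ?_
    have : (0 : ℝ) < 1 + ⟪c, x⟫ ^ 2 := by positivity
    exact this.ne'
  have hg0 : ∀ x, 0 ≤ g x := fun x => by simp only [hg]; positivity
  -- the tested integrals tend to zero
  have hlim : Tendsto (fun R : ℝ => ∫ x, cutoff R x * g x) atTop (𝓝 0) := by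
    have hup : Tendsto (fun R : ℝ => Real.pi * (C / R) *
        ∫ x in {x : EuclideanSpace ℝ (Fin 3) | R ≤ ‖x‖ ∧ ‖x‖ ≤ 2 * R}, ‖w x - c‖) atTop (𝓝 0) := by
      have h := hflux.const_mul (Real.pi * C)
      rw [mul_zero] at h
      refine h.congr' ((eventually_gt_atTop 0).mono fun R hR => ?_)
      simp only [div_eq_mul_inv]
      ring
    refine tendsto_of_tendsto_of_tendsto_of_le_of_le' tendsto_const_nhds hup
      ((eventually_gt_atTop 0).mono fun R hR => integral_nonneg fun x => mul_nonneg (cutoff_nonneg R x) (hg0 x))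
      ((eventually_gt_atTop 0).mono fun R hR => hC R hR)
  -- hence `g ≡ 0`
  intro x₀
  have hη : ∀ R, ‖x₀‖ + 1 ≤ R →
      (∫ x in closedBall (0 : EuclideanSpace ℝ (Fin 3)) (‖x₀‖ + 1), g x) ≤ ∫ x, cutoff R x * g x := by
    intro R hR
    have hR0 : 0 < R := lt_of_lt_of_le (by positivity) hR
    rw [← integral_indicator measurableSet_closedBall]
    refine integral_mono ?_ ?_ fun x => ?_
    · rw [integrable_indicator_iff measurableSet_closedBall]
      exact hgc.continuousOn.integrableOn_compact (isCompact_closedBall _ _)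
    · exact ((contDiff_cutoff (n := 1) R).continuous.mul hgc).integrable_of_hasCompactSupport
        (hasCompactSupport_cutoff hR0).mul_right
    · by_cases hx : x ∈ closedBall (0 : EuclideanSpace ℝ (Fin 3)) (‖x₀‖ + 1)
      · rw [indicator_of_mem hx, cutoff_eq_one hR0 ((mem_closedBall_zero_iff.1 hx).trans hR), one_mul]
      · rw [indicator_of_notMem hx]; exact mul_nonneg (cutoff_nonneg R x) (hg0 x)
  have hηle : (∫ x in closedBall (0 : EuclideanSpace ℝ (Fin 3)) (‖x₀‖ + 1), g x) ≤ 0 :=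
    le_of_tendsto_of_tendsto tendsto_const_nhds hlim ((eventually_ge_atTop (‖x₀‖ + 1)).mono fun R hR => hη R hR)
  have hint : IntegrableOn g (closedBall (0 : EuclideanSpace ℝ (Fin 3)) (‖x₀‖ + 1)) volume :=
    hgc.continuousOn.integrableOn_compact (isCompact_closedBall _ _)
  -- if `g x₀ > 0`, the integral over the ball would be positive
  by_contra hne
  have hVx : V x₀ ≠ 0 := fun h => hne (by simpa [hVdef, sub_eq_zero] using h)
  have hgx : 0 < g x₀ := by
    simp only [hg]
    exact div_pos (pow_pos (norm_pos_iff.2 hVx) 2) (by positivity)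
  have hpos : 0 < ∫ x in closedBall (0 : EuclideanSpace ℝ (Fin 3)) (‖x₀‖ + 1), g x := by
    rw [integral_pos_iff_support_of_nonneg_ae (Eventually.of_forall fun x => hg0 x) hint,
      Measure.restrict_apply' measurableSet_closedBall]
    -- the open set `{g > 0} ∩ ball` contains `x₀`
    have hU : IsOpen ({x | 0 < g x} ∩ ball (0 : EuclideanSpace ℝ (Fin 3)) (‖x₀‖ + 1)) :=
      (isOpen_lt continuous_const hgc).inter isOpen_ball
    have hx₀U : x₀ ∈ {x | 0 < g x} ∩ ball (0 : EuclideanSpace ℝ (Fin 3)) (‖x₀‖ + 1) :=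
      ⟨hgx, mem_ball_zero_iff.2 (by linarith)⟩
    refine lt_of_lt_of_le (hU.measure_pos volume ⟨x₀, hx₀U⟩) (measure_mono fun x hx => ?_)
    exact ⟨(hx.1 : 0 < g x).ne', ball_subset_closedBall hx.2⟩
  linarith

end ExtremiserLiouville

end Summit.NavierStokesRegularity.NavierStokesRegularity.Theorems

end
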